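import Mathlib
import HarnessLib
import Literature.MathematicalPhysics.StatisticalMechanics.LennardJonesClusters
import Summits.AtomisticToContinuum.Crystallization.Theorems.ChargedEnergyGap.Negative.Periodisation
import Summits.AtomisticToContinuum.Crystallization.Theorems.ChargedEnergyGap.Negative.BlocksBound
import Summits.AtomisticToContinuum.Crystallization.Theorems.ContactSaturationLadderWindowFilling

/-!
# `ContactSaturationLadder` / E₂ `TwelveGapTextureRung` (stmt-AtomisticToContinuum-31516): the WINDOW ENERGY FLOOR FROM FILLING (`stub_windowFloorOfFilling`)

Registered stub `stub_windowFloorOfFilling` of the line «ElasticWindow» (skeleton v6; critic row 65 content split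
`windowFloor [M] + elasticCoercivity [XL]`, v6 landing split `windowFloor = windowFloorOfFilling ∘ windowFilling`) of
E₂ = `Summit.AtomisticToContinuum.Crystallization.Theses.ContactSaturationLadder.TwelveGapTextureRung`, PROVED here with the registered
header verbatim (definition-free file; decomposition cell decomp-a2c, lens-1 «grading / quantitative ladder», g8).  Statement: IF
allowance-free doubled windows fill space (`FILL`: `ρ ≥ 9`, no `(1/60)`-loose particle in `B(p,2ρ)`, some particle there ⇒
`(ρ−9)³ ≤ 64·#B(p,ρ)` — the companion stub `stub_windowFilling`, landed modulo `L12` in `ContactSaturationLadderWindowFilling.lean`),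
THEN for every `ε > 0` there is `ρ₀` such that for all `ρ ≥ ρ₀` every window `B(p,ρ)` of a Lennard-Jones ground state whose doubled
window contains no `(1/60)`-loose particle satisfies `Σ_{B(p,ρ)} (𝓔ⁱ/2 − e⋆) ≥ −ε · #B(p,2ρ)`, `e⋆ = ⨅_Q e(Q)` over periodic
configurations (the elastic window law at price `0`).

Proof.  §1 LAYER (`card_layer_le`): the shell `{R₁ < |y_i−p| ≤ R₂}` of a `δ`-separated configuration satisfies
`#·(δ/2)³ ≤ (R₂+δ/2)³ − (R₁−δ/2)³` (disjoint `δ/2`-balls in an annulus, Lebesgue measure); two-scale shell sum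
`Σ_{k∈T} |q−y_k|⁻⁶ ≤ 250η⁻³ρ⁻³` for an `η`-separated family at distance `≥ ρ ≥ η` from `q` (`sum_inv_pow_six_le_two_scale_idx` of the companion file
`ContactSaturationLadderWindowFilling.lean`).  §2 ENERGY (`card_mul_iInf_le_half_sum`, `siteEnergy_split`):
`Σ_{i∈W} 𝓔ⁱ = Σ_{i∈W}Σ_{k∈W∖i} V + cross`, the first `≥ 2·#W·e⋆` by the tree's periodisation floor `N·e⋆ ≤ 𝓔_LJ`
(`ChargedEnergyGapNegative.card_mul_eStar_le_interactionEnergy` with item 0714's `bddBelow_energyPerParticle_lennardJones`, applied to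
the increasing reindexing of `y|W`).  §3 (`stub_windowFloorOfFilling`): `δ` = the Lennard-Jones minimal distance
(`LennardJonesMinimalDistance_holds`, capped at `1`); deep sites (`|y_i − p| ≤ ρ − r`) see the complement only beyond distance `r`
(cross terms `≥ −(250/6)δ⁻³r⁻³`), layer sites lose at most `(250/6)δ⁻⁶` (`sum_inv_pow_six_le`); the layer holds
`≤ 24δ⁻³(r+1)(ρ+1)²` particles against `#B(p,2ρ) ≥ #B(p,ρ) ≥ (ρ−9)³/64 ≥ ρ³/512` (`ρ ≥ 18`) from `FILL`; constants
`r = max(1, 2A/ε)`, `ρ₀ = max(max(21, r+1), 1024K/ε)`, `A = (250/12)δ⁻³`, `K = (250/12)δ⁻⁶·24δ⁻³(r+1)`; an empty doubled window is trivial.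
-/

namespace Summit.AtomisticToContinuum.Crystallization.Theorems.ContactSaturationLadderWindowFloor

open scoped BigOperators Classical
open MeasureTheory Metric
open Literature.MathematicalPhysics.StatisticalMechanics (lennardJones IsGroundState interactionEnergy
  PeriodicConfiguration siteEnergy LennardJonesMinimalDistance_holds
  sum_inv_pow_six_le neg_le_lennardJones_of_le card_le_of_separated_of_dist_le)
open Summit.AtomisticToContinuum.Crystallization.Theorems.ChargedEnergyGapNegative (eStar card_mul_eStar_le_interactionEnergy
  bddBelow_energyPerParticle_lennardJones)
open Summit.AtomisticToContinuum.Crystallization.Theorems.ContactSaturationLadderWindowFilling (sum_inv_pow_six_le_two_scale_idx)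

/-! ## §1 The boundary layer of a window -/

/-- **Layer count.**  In a `δ`-separated configuration the particles of the shell `{R₁ < |y_i − p| ≤ R₂}` (`δ ≤ R₁ ≤ R₂`) satisfy
`#·(δ/2)³ ≤ (R₂+δ/2)³ − (R₁−δ/2)³` (the `δ/2`-balls about them are disjoint and lie in the annulus; Lebesgue volume). -/
theorem card_layer_le {N : ℕ} (y : Fin N → EuclideanSpace ℝ (Fin 3)) {δ : ℝ} (hδ : 0 < δ)
    (hsep : ∀ k l : Fin N, k ≠ l → δ ≤ dist (y k) (y l)) (p : EuclideanSpace ℝ (Fin 3)) {R₁ R₂ : ℝ} (hR₁ : δ ≤ R₁)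
    (hR : R₁ ≤ R₂) :
    ((Finset.univ.filter fun i : Fin N => R₁ < dist (y i) p ∧ dist (y i) p ≤ R₂).card : ℝ) * (δ / 2) ^ 3
      ≤ (R₂ + δ / 2) ^ 3 - (R₁ - δ / 2) ^ 3 := by
  set L := Finset.univ.filter (fun i : Fin N => R₁ < dist (y i) p ∧ dist (y i) p ≤ R₂) with hL
  set v := volume.real (ball (0 : EuclideanSpace ℝ (Fin 3)) 1) with hv
  have hvpos : 0 < v := ENNReal.toReal_pos (measure_ball_pos volume _ one_pos).ne' measure_ball_lt_top.ne
  have hmem : ∀ i ∈ L, R₁ < dist (y i) p ∧ dist (y i) p ≤ R₂ := fun i hi => (Finset.mem_filter.1 hi).2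
  have hdisj : Set.PairwiseDisjoint (↑L : Set (Fin N)) (fun i => ball (y i) (δ / 2)) := by
    intro i _ j _ hij
    exact ball_disjoint_ball (by have := hsep i j hij; linarith)
  have hsub : (⋃ i ∈ L, ball (y i) (δ / 2)) ⊆ closedBall p (R₂ + δ / 2) \ ball p (R₁ - δ / 2) := by
    intro x hx
    rw [Set.mem_iUnion₂] at hx
    obtain ⟨i, hi, hx⟩ := hx
    rw [mem_ball] at hx
    obtain ⟨h1, h2⟩ := hmem i hi
    have ht := dist_triangle x (y i) p
    have ht' := dist_triangle (y i) x p
    rw [dist_comm (y i) x] at ht'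
    constructor
    · rw [mem_closedBall]; linarith
    · rw [mem_ball, not_lt]; linarith
  have hfin : volume (closedBall p (R₂ + δ / 2) \ ball p (R₁ - δ / 2)) ≠ ⊤ :=
    ne_top_of_le_ne_top measure_closedBall_lt_top.ne (measure_mono Set.sdiff_subset)
  have h1 := measureReal_mono (μ := volume) hsub hfin
  rw [measureReal_biUnion_finset hdisj (fun i _ => measurableSet_ball)] at h1
  have h2 : ∀ i ∈ L, volume.real (ball (y i) (δ / 2)) = (δ / 2) ^ 3 * v := by
    intro i _
    rw [hv, ← Measure.addHaar_real_closedBall_eq_addHaar_real_ball volume (y i) (δ / 2),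
      Measure.addHaar_real_closedBall _ _ (by positivity), finrank_euclideanSpace_fin]
  rw [Finset.sum_congr rfl h2, Finset.sum_const, nsmul_eq_mul] at h1
  have h3 : volume.real (closedBall p (R₂ + δ / 2) \ ball p (R₁ - δ / 2)) = (R₂ + δ / 2) ^ 3 * v - (R₁ - δ / 2) ^ 3 * v := by
    have hsubset : ball p (R₁ - δ / 2) ⊆ closedBall p (R₂ + δ / 2) :=
      ball_subset_closedBall.trans (closedBall_subset_closedBall (by linarith))
    rw [measureReal_sdiff hsubset measurableSet_ball measure_closedBall_lt_top.ne,
      ← Measure.addHaar_real_closedBall_eq_addHaar_real_ball volume p (R₁ - δ / 2),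
      Measure.addHaar_real_closedBall _ _ (by linarith : (0 : ℝ) ≤ R₂ + δ / 2),
      Measure.addHaar_real_closedBall _ _ (by linarith : (0 : ℝ) ≤ R₁ - δ / 2), finrank_euclideanSpace_fin]
  rw [h3] at h1
  have h4 : (L.card : ℝ) * (δ / 2) ^ 3 * v ≤ ((R₂ + δ / 2) ^ 3 - (R₁ - δ / 2) ^ 3) * v := by
    rw [sub_mul, mul_assoc]; exact h1
  exact le_of_mul_le_mul_right h4 hvpos

/-! ## §2 Window energy bookkeeping -/

/-- **Sub-configuration floor in site form.**  For distinct points and every index set `W`: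
`#W · e⋆ ≤ ½ Σ_{i∈W} Σ_{k∈W∖{i}} V_LJ(|y_i − y_k|)` (`e⋆ = ⨅_Q e(Q)` over periodic configurations; the tree's periodisation floor
`N·e⋆ ≤ 𝓔_LJ` applied to the increasing reindexing of `y|W`, plus double counting). -/
theorem card_mul_iInf_le_half_sum {N : ℕ} {y : Fin N → EuclideanSpace ℝ (Fin 3)} (hy : Function.Injective y)
    (W : Finset (Fin N)) :
    (W.card : ℝ) * (⨅ Q : PeriodicConfiguration 3, Q.energyPerParticle lennardJones) ≤
      (1 / 2) * ∑ i ∈ W, ∑ k ∈ W.erase i, lennardJones (dist (y i) (y k)) := by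
  set e : Fin W.card ↪o Fin N := W.orderEmbOfFin rfl with he
  have hx : Function.Injective (y ∘ ⇑e) := hy.comp e.injective
  have h1 : ((W.card : ℕ) : ℝ) * eStar ≤ interactionEnergy lennardJones (y ∘ ⇑e) :=
    card_mul_eStar_le_interactionEnergy bddBelow_energyPerParticle_lennardJones hx
  have hW : Finset.univ.map e.toEmbedding = W := Finset.map_orderEmbOfFin_univ W rfl
  have h2 : 2 * interactionEnergy lennardJones (y ∘ ⇑e) = ∑ i ∈ W, ∑ k ∈ W.erase i, lennardJones (dist (y i) (y k)) := by
    rw [Literature.MathematicalPhysics.StatisticalMechanics.two_mul_interactionEnergy]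
    conv_rhs => rw [← hW]
    rw [Finset.sum_map]
    refine Finset.sum_congr rfl fun j _ => ?_
    have hmap : (Finset.univ.map e.toEmbedding).erase (e.toEmbedding j) = (Finset.univ.erase j).map e.toEmbedding :=
      (Finset.map_erase e.toEmbedding Finset.univ j).symm
    rw [hmap, Finset.sum_map]
    simp only [siteEnergy, Function.comp_apply, RelEmbedding.coe_toEmbedding]
  have h3 : eStar = ⨅ Q : PeriodicConfiguration 3, Q.energyPerParticle lennardJones := rfl
  rw [← h3]
  linarith

/-- Splitting a site energy along an index set containing the site: `𝓔ⁱ = Σ_{k∈W∖{i}} + Σ_{k∉W}`. -/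
theorem siteEnergy_split {N : ℕ} (y : Fin N → EuclideanSpace ℝ (Fin 3)) (W : Finset (Fin N)) {i : Fin N} (hi : i ∈ W) :
    siteEnergy lennardJones y i = ∑ k ∈ W.erase i, lennardJones (dist (y i) (y k)) +
      ∑ k ∈ Finset.univ.filter (fun k : Fin N => k ∉ W), lennardJones (dist (y i) (y k)) := by
  unfold siteEnergy
  rw [← Finset.sum_filter_add_sum_filter_not (Finset.univ.erase i) (fun k => k ∈ W)]
  congr 1
  · refine Finset.sum_congr ?_ fun _ _ => rfl
    ext k
    simp only [Finset.mem_filter, Finset.mem_erase, Finset.mem_univ, and_true]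
  · refine Finset.sum_congr ?_ fun _ _ => rfl
    ext k
    simp only [Finset.mem_filter, Finset.mem_erase, Finset.mem_univ, and_true, true_and]
    constructor
    · rintro ⟨-, h⟩; exact h
    · intro h; exact ⟨fun h' => h (h' ▸ hi), h⟩

/-! ## §3 The registered stub `stub_windowFloorOfFilling` (skeleton v6 of E₂, header verbatim) -/

/-- **`stub_windowFloorOfFilling`** (registered stub of E₂ `TwelveGapTextureRung`, line «ElasticWindow», skeleton v6): the window
energy floor at price `0` on allowance-free windows of Lennard-Jones ground states, from the filling count `FILL`. -/
theorem stub_windowFloorOfFilling : (∀ (N : ℕ) (y : Fin N → EuclideanSpace ℝ (Fin 3)) (p : EuclideanSpace ℝ (Fin 3)) (ρ : ℝ), 9 ≤ ρ → (∀ i : Fin N, dist (y i) p ≤ 2 * ρ → i ∉ (Finset.univ.filter fun j : Fin N => ∀ d : ℝ, ¬ (3 / 4 ≤ d ∧ d ≤ 6 / 5 ∧ (∀ k l : Fin N, k ≠ l → dist (y k) (y j) ≤ 6 → dist (y l) (y j) ≤ 6 → d ≤ dist (y k) (y l)) ∧ (∀ k : Fin N, dist (y k) (y j) ≤ 5 →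 12 ≤ (Finset.univ.filter fun l => l ≠ k ∧ dist (y l) (y k) ≤ (1 + 1 / 60) * d).card)))) → (∃ i : Fin N, dist (y i) p ≤ 2 * ρ) → (ρ - 9) ^ 3 ≤ 64 * ((Finset.univ.filter fun i : Fin N => dist (y i) p ≤ ρ).card : ℝ)) → ∀ ε : ℝ, 0 < ε → ∃ ρ₀ : ℝ, 0 < ρ₀ ∧ ∀ ρ : ℝ, ρ₀ ≤ ρ → ∀ (N : ℕ) (y : Fin N → EuclideanSpace ℝ (Fin 3)), Literature.MathematicalPhysics.StatisticalMechanics.IsGroundState Literature.MathematicalPhysics.StatisticalMechanics.lennardJones y → ∀ p : EuclideanSpace ℝ (Fin 3), (∀ i : Fin N, dist (y i) p ≤ 2 * ρ → i ∉ (Finset.univ.filter fun j : Fin N => ∀ d : ℝ, ¬ (3 / 4 ≤ d ∧ d ≤ 6 / 5 ∧ (∀ k l : Fin N, k ≠ l → dist (y k) (y j) ≤ 6 → dist (y l) (y j) ≤ 6 → d ≤ dist (y k) (y l)) ∧ (∀ k : Fin N, dist (y k) (y j) ≤ 5 → 12 ≤ (Finset.univ.filter fun l => l ≠ k ∧ dist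 (y l) (y k) ≤ (1 + 1 / 60) * d).card)))) → 0 * (((Finset.univ.filter fun j : Fin N => ∀ d : ℝ, ¬ (3 / 4 ≤ d ∧ d ≤ 6 / 5 ∧ (∀ k l : Fin N, k ≠ l → dist (y k) (y j) ≤ 6 → dist (y l) (y j) ≤ 6 → d ≤ dist (y k) (y l)) ∧ (∀ k : Fin N, dist (y k) (y j) ≤ 5 → 12 ≤ (Finset.univ.filter fun l => l ≠ k ∧ dist (y l) (y k) ≤ (1 + 1 / 2000) * d).card))).filter fun i : Fin N => dist (y i) p ≤ ρ).card : ℝ) - ε * ((Finset.univ.filter fun i : Fin N => dist (y i) p ≤ 2 * ρ).card : ℝ) ≤ ∑ i ∈ Finset.univ.filter (fun i : Fin N => dist (y i) p ≤ ρ), (Literature.MathematicalPhysics.StatisticalMechanics.siteEnergy Literature.MathematicalPhysics.StatisticalMechanics.lennardJones y i / 2 - (⨅ Q : Literature.MathematicalPhysics.StatisticalMechanics.PeriodicConfiguration 3, Q.energyPerParticle Literature.MathematicalPhysics.StatisticalMechanics.lennardJones)) := by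
  intro hFill ε hε
  obtain ⟨δ₀, hδ₀, hsep₀⟩ := LennardJonesMinimalDistance_holds
  set δ : ℝ := min δ₀ 1 with hδdef
  have hδ : 0 < δ := lt_min hδ₀ one_pos
  have hδ1 : δ ≤ 1 := min_le_right _ _
  have hδle : δ ≤ δ₀ := min_le_left _ _
  set A : ℝ := 250 / 12 * δ⁻¹ ^ 3 with hA
  set B : ℝ := 250 / 12 * δ⁻¹ ^ 6 with hB
  have hA0 : 0 < A := by rw [hA]; positivity
  have hB0 : 0 < B := by rw [hB]; positivity
  set r : ℝ := max 1 (2 * A / ε) with hr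
  have hr1 : 1 ≤ r := le_max_left _ _
  have hrpos : 0 < r := by linarith
  have hδr : δ ≤ r := hδ1.trans hr1
  have hAr : A * r⁻¹ ^ 3 ≤ ε / 2 := by
    have h1 : r⁻¹ ^ 3 ≤ r⁻¹ := by
      have h0 : 0 ≤ r⁻¹ := inv_nonneg.2 hrpos.le
      have h1 : r⁻¹ ≤ 1 := inv_le_one_of_one_le₀ hr1
      calc r⁻¹ ^ 3 = r⁻¹ * (r⁻¹ * r⁻¹) := by ring
        _ ≤ r⁻¹ * (1 * 1) := mul_le_mul_of_nonneg_left (mul_le_mul h1 h1 h0 zero_le_one) h0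
        _ = r⁻¹ := by ring
    have h2 : 2 * A / ε ≤ r := le_max_right _ _
    have h3 : A * r⁻¹ ≤ ε / 2 := by
      rw [div_le_iff₀ hε] at h2
      rw [← div_eq_mul_inv, div_le_iff₀ hrpos]
      linarith
    calc A * r⁻¹ ^ 3 ≤ A * r⁻¹ := by gcongr
      _ ≤ ε / 2 := h3
  set K : ℝ := B * (24 * δ⁻¹ ^ 3 * (r + 1)) with hK
  have hK0 : 0 < K := by rw [hK]; positivity
  set ρ₀ : ℝ := max (max 21 (r + 1)) (1024 * K / ε) with hρ₀
  have hρ₀pos : 0 < ρ₀ := lt_of_lt_of_le (by norm_num) ((le_max_left _ _).trans (le_max_left _ _))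
  refine ⟨ρ₀, hρ₀pos, ?_⟩
  intro ρ hρ N y hy p hAfree
  have hρ21 : 21 ≤ ρ := ((le_max_left _ _).trans (le_max_left _ _)).trans hρ
  have hρr : r + 1 ≤ ρ := ((le_max_right _ _).trans (le_max_left _ _)).trans hρ
  have hρK : 1024 * K / ε ≤ ρ := (le_max_right _ _).trans hρ
  simp only [zero_mul, zero_sub]
  have hsep : ∀ k l : Fin N, k ≠ l → δ ≤ dist (y k) (y l) := fun k l hkl => hδle.trans (hsep₀ N y hy k l hkl)
  have hyinj : Function.Injective y := hy.1
  -- the (nonlinear) counts, before the window sets are made opaque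
  have hWcard0 : (∃ i : Fin N, dist (y i) p ≤ 2 * ρ) →
      (ρ - 9) ^ 3 ≤ 64 * ((Finset.univ.filter fun i : Fin N => dist (y i) p ≤ ρ).card : ℝ) := fun hne =>
    hFill N y p ρ (by linarith only [hρ21]) hAfree hne
  have hLay0 : ((Finset.univ.filter fun i : Fin N => ρ - r < dist (y i) p ∧ dist (y i) p ≤ ρ).card : ℝ) * (δ / 2) ^ 3
      ≤ (ρ + δ / 2) ^ 3 - (ρ - r - δ / 2) ^ 3 :=
    card_layer_le y hδ hsep p (by linarith only [hρr, hδ1] : δ ≤ ρ - r) (by linarith only [hrpos] : ρ - r ≤ ρ)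
  set W := Finset.univ.filter (fun i : Fin N => dist (y i) p ≤ ρ) with hW
  set W2 := Finset.univ.filter (fun i : Fin N => dist (y i) p ≤ 2 * ρ) with hW2
  set Lay := Finset.univ.filter (fun i : Fin N => ρ - r < dist (y i) p ∧ dist (y i) p ≤ ρ) with hLay
  clear_value W W2 Lay
  have hmW : ∀ i : Fin N, i ∈ W ↔ dist (y i) p ≤ ρ := fun i => by rw [hW]; simp
  have hmW2 : ∀ i : Fin N, i ∈ W2 ↔ dist (y i) p ≤ 2 * ρ := fun i => by rw [hW2]; simp
  have hmLay : ∀ i : Fin N, i ∈ Lay ↔ ρ - r < dist (y i) p ∧ dist (y i) p ≤ ρ := fun i => by rw [hLay]; simp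
  by_cases hne : ∃ i : Fin N, dist (y i) p ≤ 2 * ρ
  · have hWcard : (ρ - 9) ^ 3 ≤ 64 * (W.card : ℝ) := hWcard0 hne
    have hWW2 : W ⊆ W2 := by
      intro i hi
      rw [hmW] at hi
      rw [hmW2]
      linarith only [hi, hρ21]
    have hcardle : (W.card : ℝ) ≤ W2.card := by exact_mod_cast Finset.card_le_card hWW2
    -- the boundary layer is thin
    have hLay2 : (Lay.card : ℝ) ≤ 24 * δ⁻¹ ^ 3 * (r + 1) * (ρ + 1) ^ 2 := by
      have hb : 0 ≤ ρ - r - δ / 2 := by linarith only [hρr, hδ1]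
      have ha : ρ + δ / 2 ≤ ρ + 1 := by linarith only [hδ1]
      have hab : (ρ + δ / 2) ^ 3 - (ρ - r - δ / 2) ^ 3 ≤ 3 * (ρ + 1) ^ 2 * (r + 1) := by
        have ha0 : 0 ≤ ρ + δ / 2 := by linarith only [hb, hrpos, hδ]
        have hb' : ρ - r - δ / 2 ≤ ρ + δ / 2 := by linarith only [hrpos, hδ]
        have h1 : (ρ + δ / 2) ^ 3 - (ρ - r - δ / 2) ^ 3 =
            (r + δ) * ((ρ + δ / 2) ^ 2 + (ρ + δ / 2) * (ρ - r - δ / 2) + (ρ - r - δ / 2) ^ 2) := by ring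
        have hb2 : (ρ - r - δ / 2) ^ 2 ≤ (ρ + δ / 2) ^ 2 := pow_le_pow_left₀ hb hb' 2
        have hab2 : (ρ + δ / 2) * (ρ - r - δ / 2) ≤ (ρ + δ / 2) ^ 2 := by
          rw [sq]; exact mul_le_mul_of_nonneg_left hb' ha0
        have ha2 : (ρ + δ / 2) ^ 2 ≤ (ρ + 1) ^ 2 := pow_le_pow_left₀ ha0 ha 2
        have h2 : (ρ + δ / 2) ^ 2 + (ρ + δ / 2) * (ρ - r - δ / 2) + (ρ - r - δ / 2) ^ 2 ≤ 3 * (ρ + 1) ^ 2 := by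
          linarith only [hb2, hab2, ha2]
        have h3 : 0 ≤ r + δ := by linarith only [hrpos, hδ]
        have h4 : (0 : ℝ) ≤ 3 * (ρ + 1) ^ 2 := by positivity
        rw [h1]
        calc (r + δ) * ((ρ + δ / 2) ^ 2 + (ρ + δ / 2) * (ρ - r - δ / 2) + (ρ - r - δ / 2) ^ 2)
            ≤ (r + δ) * (3 * (ρ + 1) ^ 2) := mul_le_mul_of_nonneg_left h2 h3
          _ ≤ (r + 1) * (3 * (ρ + 1) ^ 2) := mul_le_mul_of_nonneg_right (by linarith only [hδ1]) h4
          _ = 3 * (ρ + 1) ^ 2 * (r + 1) := by ring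
      have h := hLay0.trans hab
      have hδ3 : (0 : ℝ) < (δ / 2) ^ 3 := by positivity
      have hδ0 : δ ≠ 0 := hδ.ne'
      calc (Lay.card : ℝ) ≤ 3 * (ρ + 1) ^ 2 * (r + 1) / (δ / 2) ^ 3 := (le_div_iff₀ hδ3).2 h
        _ = 24 * δ⁻¹ ^ 3 * (r + 1) * (ρ + 1) ^ 2 := by field_simp; ring
    -- per-site cross interaction with the complement of the window
    have hcross : ∀ i ∈ W, -(2 * A * r⁻¹ ^ 3) - (if ρ - r < dist (y i) p then 2 * B else 0) ≤
        ∑ k ∈ Finset.univ.filter (fun k : Fin N => k ∉ W), lennardJones (dist (y i) (y k)) := by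
      intro i hi
      have hip : dist (y i) p ≤ ρ := (hmW i).1 hi
      set T := Finset.univ.filter (fun k : Fin N => k ∉ W) with hT
      clear_value T
      have hmT : ∀ k : Fin N, k ∈ T ↔ k ∉ W := fun k => by rw [hT]; simp
      have hTi : ∀ k ∈ T, k ≠ i := fun k hk h => ((hmT k).1 hk) (h ▸ hi)
      have hterm : ∀ k ∈ T, -((1 / 6) * (dist (y i) (y k))⁻¹ ^ 6) ≤ lennardJones (dist (y i) (y k)) := fun k hk =>
        neg_le_lennardJones_of_le (lt_of_lt_of_le hδ (hsep i k (hTi k hk).symm)) le_rfl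
      have hsumT : -((1 / 6) * ∑ k ∈ T, (dist (y i) (y k))⁻¹ ^ 6) ≤ ∑ k ∈ T, lennardJones (dist (y i) (y k)) := by
        rw [Finset.mul_sum, ← Finset.sum_neg_distrib]
        exact Finset.sum_le_sum hterm
      have hAr0 : 0 ≤ 2 * A * r⁻¹ ^ 3 := by positivity
      split_ifs with hlay
      · have h1 : ∑ k ∈ T, (dist (y i) (y k))⁻¹ ^ 6 ≤ ∑ k ∈ Finset.univ.erase i, (dist (y i) (y k))⁻¹ ^ 6 :=
          Finset.sum_le_sum_of_subset_of_nonneg (fun k hk => Finset.mem_erase.2 ⟨hTi k hk, Finset.mem_univ _⟩)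
            (fun _ _ _ => by positivity)
        have h2 := sum_inv_pow_six_le y hδ hsep i
        have hB' : (1 / 6 : ℝ) * (250 * δ⁻¹ ^ 6) = 2 * B := by rw [hB]; ring
        linarith only [hsumT, h1, h2, hB', hAr0]
      · push Not at hlay
        have hfar : ∀ k ∈ T, r ≤ dist (y i) (y k) := by
          intro k hk
          have hkW : k ∉ W := (hmT k).1 hk
          have hkp : ρ < dist (y k) p := by
            by_contra h
            push Not at h
            exact hkW ((hmW k).2 h)
          have ht := dist_triangle (y k) (y i) p
          rw [dist_comm (y k) (y i)] at ht
          linarith only [hlay, hkp, ht]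
        have h2 := sum_inv_pow_six_le_two_scale_idx y T (y i) hδ hδr (fun k _ l _ hkl => hsep k l hkl) hfar
        have hA'' : (1 / 6 : ℝ) * (250 * δ⁻¹ ^ 3 * r⁻¹ ^ 3) = 2 * A * r⁻¹ ^ 3 := by rw [hA]; ring
        linarith only [hsumT, h2, hA'']
    -- summing the site energies over the window
    have hsum : 2 * ((W.card : ℝ) * (⨅ Q : PeriodicConfiguration 3, Q.energyPerParticle lennardJones))
        - 2 * A * r⁻¹ ^ 3 * W.card - 2 * B * Lay.card ≤ ∑ i ∈ W, siteEnergy lennardJones y i := by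
      have hfloor := card_mul_iInf_le_half_sum hyinj W
      have hsite : ∑ i ∈ W, siteEnergy lennardJones y i =
          ∑ i ∈ W, ∑ k ∈ W.erase i, lennardJones (dist (y i) (y k)) +
          ∑ i ∈ W, ∑ k ∈ Finset.univ.filter (fun k : Fin N => k ∉ W), lennardJones (dist (y i) (y k)) := by
        rw [← Finset.sum_add_distrib]
        exact Finset.sum_congr rfl fun i hi => siteEnergy_split y W hi
      have hc := Finset.sum_le_sum hcross
      have hite : ∑ i ∈ W, (-(2 * A * r⁻¹ ^ 3) - (if ρ - r < dist (y i) p then 2 * B else 0)) =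
          -(2 * A * r⁻¹ ^ 3) * W.card - 2 * B * Lay.card := by
        rw [Finset.sum_sub_distrib, Finset.sum_const, nsmul_eq_mul, Finset.sum_ite, Finset.sum_const_zero, add_zero,
          Finset.sum_const, nsmul_eq_mul]
        have hfl : W.filter (fun i => ρ - r < dist (y i) p) = Lay := by
          ext i
          rw [Finset.mem_filter, hmW, hmLay]
          tauto
        rw [hfl]
        ring
      rw [hite] at hc
      rw [hsite]
      linarith only [hfloor, hc]
    -- the layer and the far tails are cheap compared with the doubled window
    have hε0 : 0 ≤ ε / 1024 := div_nonneg hε.le (by norm_num)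
    have hK1 : K * (ρ + 1) ^ 2 ≤ ε / 1024 * (ρ + 1) ^ 3 := by
      have h : 1024 * K ≤ ε * (ρ + 1) := by
        have h' := (div_le_iff₀ hε).1 hρK
        linarith only [h', hε, hK0]
      have h0 : (0 : ℝ) ≤ (ρ + 1) ^ 2 := sq_nonneg _
      calc K * (ρ + 1) ^ 2 = (1024 * K) * (ρ + 1) ^ 2 / 1024 := by ring
        _ ≤ (ε * (ρ + 1)) * (ρ + 1) ^ 2 / 1024 :=
            div_le_div_of_nonneg_right (mul_le_mul_of_nonneg_right h h0) (by norm_num)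
        _ = ε / 1024 * (ρ + 1) ^ 3 := by ring
    have hK2 : (ρ + 1) ^ 3 ≤ 8 * (ρ - 9) ^ 3 := by
      have h : ρ + 1 ≤ 2 * (ρ - 9) := by linarith only [hρ21]
      have h0 : 0 ≤ ρ + 1 := by linarith only [hρ21]
      calc (ρ + 1) ^ 3 ≤ (2 * (ρ - 9)) ^ 3 := pow_le_pow_left₀ h0 h 3
        _ = 8 * (ρ - 9) ^ 3 := by ring
    have hBL : B * Lay.card ≤ ε / 2 * W2.card := by
      have h1 : B * (Lay.card : ℝ) ≤ B * (24 * δ⁻¹ ^ 3 * (r + 1) * (ρ + 1) ^ 2) := mul_le_mul_of_nonneg_left hLay2 hB0.le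
      have h2 : B * (24 * δ⁻¹ ^ 3 * (r + 1) * (ρ + 1) ^ 2) = K * (ρ + 1) ^ 2 := by rw [hK]; ring
      have h4 : ε / 1024 * (ρ + 1) ^ 3 ≤ ε / 1024 * (8 * (ρ - 9) ^ 3) := mul_le_mul_of_nonneg_left hK2 hε0
      have h5 : ε / 1024 * (8 * (ρ - 9) ^ 3) ≤ ε / 1024 * (8 * (64 * (W.card : ℝ))) :=
        mul_le_mul_of_nonneg_left (by linarith only [hWcard]) hε0
      have h6 : ε / 2 * (W.card : ℝ) ≤ ε / 2 * W2.card := mul_le_mul_of_nonneg_left hcardle (by linarith only [hε])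
      linarith only [h1, h2, hK1, h4, h5, h6]
    have hAW : A * r⁻¹ ^ 3 * W.card ≤ ε / 2 * W2.card := by
      have h7 : A * r⁻¹ ^ 3 * (W.card : ℝ) ≤ ε / 2 * W.card := mul_le_mul_of_nonneg_right hAr (Nat.cast_nonneg _)
      have h6 : ε / 2 * (W.card : ℝ) ≤ ε / 2 * W2.card := mul_le_mul_of_nonneg_left hcardle (by linarith only [hε])
      exact h7.trans h6
    rw [Finset.sum_sub_distrib, Finset.sum_const, nsmul_eq_mul, ← Finset.sum_div]
    linarith only [hsum, hBL, hAW]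
  · push Not at hne
    have hW0 : W = ∅ := by
      rw [Finset.eq_empty_iff_forall_notMem]
      intro i hi
      have h := (hmW i).1 hi
      have h' := hne i
      linarith only [h, h', hρ21]
    have hW20 : W2 = ∅ := by
      rw [Finset.eq_empty_iff_forall_notMem]
      intro i hi
      exact absurd ((hmW2 i).1 hi) (not_le.2 (hne i))
    rw [hW0, hW20]
    simp

end Summit.AtomisticToContinuum.Crystallization.Theorems.ContactSaturationLadderWindowFloor
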